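import Summits.CriticalPhenomena.CardyFormulaZ2.Theorems.CardyBoundaryCoulombGasRectilinearCardyClosureDefs
import Summits.CriticalPhenomena.CardyFormulaZ2.Theorems.RectilinearCardy.Negative.RectilinearCardyReductions
import Summits.CriticalPhenomena.CardyFormulaZ2.Theorems.CardyBoundaryCoulombGasRectilinearCardyLocalSide
import Summits.CriticalPhenomena.CardyFormulaZ2.Theorems.CardyBoundaryCoulombGasRectilinearCardyStubOrientationPart1
import HarnessLib

/-!
# Stub stub_orientation of line excursion-kernel-covariance (crux RectilinearCardy,
# stmt-CriticalPhenomena-5660): orientation at a flat mark and its matching with a half-plane chart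

For a conformal rectangle `R = (Ω; a, b, c, d)` with flat marks, at the mark `a = pt 0`:

* (i) the ORIENTATION DICHOTOMY (`orientation_dichotomy_at_pt_zero`, part 1 file): an axis
  direction `u ∈ {1, i, -1, -i}` and `r > 0` with the loop moving strictly forward along `u` for
  parameters in `(mark 0 - r, mark 0 + r)` and the domain meeting `B(a, r)` in exactly the left
  (`b = false`) or the right (`b = true`) open half-disc;
* (ii) MATCHING (`ori_matching`, this file): if `w` is holomorphic on an open `U ∋ a`, maps `Ω`
  into the upper half-plane and has real boundary values `g` near `mark 0`, strictly monotone or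
  antitone on `[S₀, S] ∋ mark 0`, then `b = false` forces `g` increasing and `b = true`
  decreasing. At a boundary point `q` with `Ω` to the left of the tangent direction `d`,
  `Im w > 0` on `q + i d (0, ε)` and `w q ∈ ℝ` give `Re (w′(q) d) ≥ 0` (one-sided difference
  quotient, `HasDerivAt.tendsto_slope_zero_right`; `ori_re_deriv_mul_nonneg`), so `Re w` is
  non-decreasing along `d` on the boundary segment filled by a short parameter window
  (`monotoneOn_of_deriv_nonneg`; `ori_re_le_re_of_left`), contradicting strict antitonicity
  (`d = u`, `b = false`) resp. monotonicity (`d = -u`, `b = true`) of `g` at the window ends.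

Sources: folklore (boundary behaviour of conformal maps at analytic arcs, e.g. Pommerenke,
*Boundary Behaviour of Conformal Maps* (1992), Ch. 1–2); the line card
`Cruxes/RectilinearCardy/Lines/excursion-kernel-covariance.md`.
-/

noncomputable section

open Set Filter Topology MeasureTheory Metric
open Literature.Probability.RandomPlanarGeometry
open Literature.Probability.LatticeModels (Site meshPoint zdGraph)
open Summit.CriticalPhenomena.CardyFormulaZ2.Theorems.RectilinearCardy.Negative (IsRectilinear)

namespace Summit.CriticalPhenomena.CardyFormulaZ2.Cruxes.RectilinearCardy.ExcursionKernelCovariance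

/-! ### Part (ii): matching the side with a half-plane chart -/

/-- **Sign of the derivative at a real boundary value with the upper half-plane to the left.**
If `w` is complex-differentiable at `q`, `w q` is real and `Im w ≥ 0` at the points
`q + y i d`, `y → 0⁺`, then `Re (w′(q) d) ≥ 0` (one-sided difference quotient). [folklore] -/
theorem ori_re_deriv_mul_nonneg {w : ℂ → ℂ} {q d : ℂ} (hw : DifferentiableAt ℂ w q)
    (hq : (w q).im = 0)
    (hpos : ∀ᶠ y : ℝ in 𝓝[>] 0, 0 ≤ (w (q + (y : ℂ) * (Complex.I * d))).im) :
    0 ≤ (deriv w q * d).re := by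
  have hin : HasDerivAt (fun z : ℂ => q + z * (Complex.I * d)) (Complex.I * d) ((0 : ℝ) : ℂ) := by
    simpa using ((hasDerivAt_id ((0 : ℝ) : ℂ)).mul_const (Complex.I * d)).const_add q
  have hd : HasDerivAt (fun y : ℝ => w (q + (y : ℂ) * (Complex.I * d)))
      (deriv w q * (Complex.I * d)) 0 :=
    (hw.hasDerivAt.comp_of_eq _ hin (by simp)).comp_ofReal
  have ht := (Complex.continuous_im.tendsto _).comp hd.tendsto_slope_zero_right
  have hlim : 0 ≤ (deriv w q * (Complex.I * d)).im := by
    refine ge_of_tendsto ht ?_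
    filter_upwards [hpos, self_mem_nhdsWithin] with t h0 ht0
    simp only [Function.comp_apply, zero_add, Complex.ofReal_zero, zero_mul, add_zero,
      Complex.smul_im, Complex.sub_im, hq, sub_zero, smul_eq_mul]
    exact mul_nonneg (inv_nonneg.2 (le_of_lt ht0)) h0
  have h7 : (deriv w q * (Complex.I * d)).im = (deriv w q * d).re := by
    rw [mul_left_comm, Complex.I_mul_im]
  rwa [h7] at hlim

/-- **`Re w` is non-decreasing along a segment on which `Re (w′ d) ≥ 0`.** [folklore] -/
theorem ori_re_le_re_of_deriv {U : Set ℂ} {w : ℂ → ℂ} (hU : IsOpen U)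
    (hw : DifferentiableOn ℂ w U) {p d : ℂ} {l : ℝ} (hl : 0 ≤ l)
    (hseg : ∀ s ∈ Icc 0 l, p + (s : ℂ) * d ∈ U)
    (hder : ∀ s ∈ Ioo 0 l, 0 ≤ (deriv w (p + (s : ℂ) * d) * d).re) :
    (w p).re ≤ (w (p + (l : ℂ) * d)).re := by
  have hderiv : ∀ s ∈ Icc 0 l, HasDerivAt (fun x : ℝ => (w (p + (x : ℂ) * d)).re)
      (deriv w (p + (s : ℂ) * d) * d).re s := by
    intro s hs
    have hws : HasDerivAt w (deriv w (p + (s : ℂ) * d)) (p + (s : ℂ) * d) :=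
      (hw.differentiableAt (hU.mem_nhds (hseg s hs))).hasDerivAt
    have hin : HasDerivAt (fun z : ℂ => p + z * d) d (s : ℂ) := by
      simpa using ((hasDerivAt_id (s : ℂ)).mul_const d).const_add p
    exact (hws.comp_of_eq _ hin rfl).real_of_complex
  have hmono : MonotoneOn (fun x : ℝ => (w (p + (x : ℂ) * d)).re) (Icc 0 l) := by
    refine monotoneOn_of_deriv_nonneg (convex_Icc 0 l)
      (fun s hs => (hderiv s hs).continuousAt.continuousWithinAt) ?_ ?_
    · intro s hs
      rw [interior_Icc] at hs
      exact (hderiv s (Ioo_subset_Icc_self hs)).differentiableAt.differentiableWithinAt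
    · intro s hs
      rw [interior_Icc] at hs
      rw [(hderiv s (Ioo_subset_Icc_self hs)).deriv]
      exact hder s hs
  simpa using hmono (left_mem_Icc.2 hl) (right_mem_Icc.2 hl) hl

/-- **Local monotonicity of `Re w` along a boundary segment with the domain on its left.** If the
segment `p + [0, l] d` lies in `U`, `w` is real on it, and the points `p + s d + y i d`,
`0 < y < ε`, lie in a set on which `Im w > 0`, then `Re w p ≤ Re w (p + l d)`. [folklore] -/
theorem ori_re_le_re_of_left {Ω U : Set ℂ} {w : ℂ → ℂ} (hU : IsOpen U)
    (hw : DifferentiableOn ℂ w U) (hmaps : MapsTo w Ω {z : ℂ | 0 < z.im}) {p d : ℂ} {l ε : ℝ}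
    (hl : 0 ≤ l) (hε : 0 < ε) (hseg : ∀ s ∈ Icc 0 l, p + (s : ℂ) * d ∈ U)
    (hreal : ∀ s ∈ Icc 0 l, (w (p + (s : ℂ) * d)).im = 0)
    (hleft : ∀ s ∈ Icc 0 l, ∀ y ∈ Ioo 0 ε, p + (s : ℂ) * d + (y : ℂ) * (Complex.I * d) ∈ Ω) :
    (w p).re ≤ (w (p + (l : ℂ) * d)).re := by
  refine ori_re_le_re_of_deriv hU hw hl hseg fun s hs => ?_
  have hs' : s ∈ Icc 0 l := Ioo_subset_Icc_self hs
  refine ori_re_deriv_mul_nonneg (hw.differentiableAt (hU.mem_nhds (hseg s hs'))) (hreal s hs') ?_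
  filter_upwards [Ioo_mem_nhdsGT hε] with y hy
  exact le_of_lt (hmaps (hleft s hs' y hy))

/-- **Matching the side with a half-plane chart** (part (ii) of the stub). Given the data of the
orientation dichotomy at `a = pt 0` (forward direction `u`, radius `r`, side `b`), a chart `w`
holomorphic on an open `U ∋ a`, mapping `Ω` into the upper half-plane, with real boundary values
`g` on `[S₀, S] ∋ mark 0` that are strictly monotone or antitone: `b = false` (domain to the left)
forces `g` increasing, `b = true` (domain to the right) forces `g` decreasing. Proof: on a short
parameter window `[mark 0, mark 0 + δ]` the loop fills a segment `a + [0, l] u` inside `U`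
(intermediate value theorem) on which `w = g` is real; `Re w` is non-decreasing along `u`
(`b = false`) or along `-u` (`b = true`) by `ori_re_le_re_of_left`, which contradicts strict
antitonicity (resp. monotonicity) of `g` at the two window ends. [folklore] -/
theorem ori_matching (R : ConformalRectangle) {b : Bool} {u : ℂ}
    (hu : u = 1 ∨ u = Complex.I ∨ u = -1 ∨ u = -Complex.I) {r : ℝ} (hr : 0 < r)
    (hfwd : ∀ t t' : ℝ, R.mark 0 - r < t → t < t' → t' < R.mark 0 + r →
      0 < ((R.boundary t' - R.boundary t) / u).re ∧ ((R.boundary t' - R.boundary t) / u).im = 0)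
    (hside : ∀ z : ℂ, dist z (R.pt 0) < r →
      (z ∈ R.carrier ↔ 0 < (if b then -((z - R.pt 0) / u).im else ((z - R.pt 0) / u).im)))
    (U : Set ℂ) (w : ℂ → ℂ) (g : ℝ → ℝ) (S₀ S : ℝ) (hU : IsOpen U) (hpU : R.pt 0 ∈ U)
    (hw : DifferentiableOn ℂ w U) (hmaps : MapsTo w R.carrier {z : ℂ | 0 < z.im})
    (hS₀ : S₀ < R.mark 0) (hS : R.mark 0 < S)
    (hg : ∀ t ∈ Icc S₀ S, R.boundary t ∈ U → w (R.boundary t) = g t)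
    (hga : StrictMonoOn g (Icc S₀ S) ∨ StrictAntiOn g (Icc S₀ S)) :
    (b = false → StrictMonoOn g (Icc S₀ S)) ∧ (b = true → StrictAntiOn g (Icc S₀ S)) := by
  have hu1 : ‖u‖ = 1 := ori_norm_eq_one hu
  have hu0 : u ≠ 0 := norm_ne_zero_iff.1 (by rw [hu1]; exact one_ne_zero)
  set p := R.pt 0 with hp
  set μ := R.mark 0 with hμ
  have hpμ : R.boundary μ = p := rfl
  -- a ball inside `U` and a parameter window mapped into `B(p, min (r / 2) ρ)`
  obtain ⟨ρ, hρ, hρU⟩ : ∃ ρ > 0, ball p ρ ⊆ U := Metric.isOpen_iff.1 hU p hpU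
  obtain ⟨δ₁, hδ₁, hδ₁r⟩ : ∃ δ₁ > 0, ∀ ⦃t : ℝ⦄, dist t μ < δ₁ →
      dist (R.boundary t) p < min (r / 2) ρ := by
    have h := Metric.continuousAt_iff.1 (R.continuous_boundary.continuousAt (x := μ))
      (min (r / 2) ρ) (lt_min (half_pos hr) hρ)
    rwa [hpμ] at h
  set δ := min (min δ₁ r) (S - μ) / 2 with hδdef
  have hδ : 0 < δ := by
    rw [hδdef]; exact div_pos (lt_min (lt_min hδ₁ hr) (by linarith)) two_pos
  have hδδ₁ : δ < δ₁ := by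
    rw [hδdef]; have := (min_le_left _ (S - μ)).trans (min_le_left δ₁ r); linarith
  have hδr : δ < r := by
    rw [hδdef]; have := (min_le_left _ (S - μ)).trans (min_le_right δ₁ r); linarith
  have hδS : δ < S - μ := by
    rw [hδdef]; have := min_le_right (min δ₁ r) (S - μ); linarith
  -- the window `[μ, μ + δ]`
  have hwin : ∀ t ∈ Icc μ (μ + δ), dist (R.boundary t) p < min (r / 2) ρ := fun t ht =>
    hδ₁r (by rw [Real.dist_eq, abs_lt]; constructor <;> linarith [ht.1, ht.2])
  have htS : ∀ t ∈ Icc μ (μ + δ), t ∈ Icc S₀ S := fun t ht =>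
    ⟨by linarith [ht.1], by linarith [ht.2]⟩
  have hγU : ∀ t ∈ Icc μ (μ + δ), R.boundary t ∈ U := fun t ht =>
    hρU (mem_ball.2 (lt_of_lt_of_le (hwin t ht) (min_le_right _ _)))
  have hwg : ∀ t ∈ Icc μ (μ + δ), w (R.boundary t) = g t := fun t ht =>
    hg t (htS t ht) (hγU t ht)
  -- the coordinate along `u`
  set e : ℝ → ℝ := fun t => ((R.boundary t - p) / u).re with he
  have he_cont : Continuous e := by
    rw [he]
    exact Complex.continuous_re.comp ((R.continuous_boundary.sub continuous_const).div_const u)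
  have heμ : e μ = 0 := by simp [he, hpμ]
  have he_eq : ∀ t ∈ Icc μ (μ + δ), R.boundary t = p + (e t : ℂ) * u := by
    intro t ht
    have him : ((R.boundary t - p) / u).im = 0 := by
      rcases ht.1.eq_or_lt with h | h
      · rw [← h, hpμ, sub_self, zero_div, Complex.zero_im]
      · exact hpμ ▸ (hfwd μ t (by linarith) h (by linarith [ht.2])).2
    have h1 : (R.boundary t - p) / u = (e t : ℂ) :=
      Complex.ext (by simp [he]) (by rw [Complex.ofReal_im]; exact him)
    rw [← h1, div_mul_cancel₀ _ hu0, add_sub_cancel]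
  -- the length `l` of the boundary segment over the window
  set l := e (μ + δ) with hl
  have hl0 : 0 < l := by
    have h := (hfwd μ (μ + δ) (by linarith) (by linarith) (by linarith)).1
    rwa [hpμ] at h
  have hlr : l < r / 2 := by
    have h1 : |l| ≤ ‖(R.boundary (μ + δ) - p) / u‖ := Complex.abs_re_le_norm _
    rw [norm_div, hu1, div_one, ← dist_eq_norm] at h1
    have h2 := lt_of_lt_of_le (hwin (μ + δ) ⟨by linarith, le_rfl⟩) (min_le_left _ _)
    linarith [le_abs_self l]
  -- filling: every point of the segment is a boundary point of the window
  have hfill : ∀ s ∈ Icc 0 l, ∃ t ∈ Icc μ (μ + δ), R.boundary t = p + (s : ℂ) * u := by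
    intro s hs
    have hs' : s ∈ Icc (e μ) (e (μ + δ)) := by rwa [heμ]
    obtain ⟨t, ht, hts⟩ := intermediate_value_Icc (by linarith) he_cont.continuousOn hs'
    exact ⟨t, ht, by rw [he_eq t ht, hts]⟩
  have hsegU : ∀ s ∈ Icc 0 l, p + (s : ℂ) * u ∈ U := by
    intro s hs
    obtain ⟨t, ht, hts⟩ := hfill s hs
    exact hts ▸ hγU t ht
  have hreal : ∀ s ∈ Icc 0 l, (w (p + (s : ℂ) * u)).im = 0 := by
    intro s hs
    obtain ⟨t, ht, hts⟩ := hfill s hs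
    rw [← hts, hwg t ht, Complex.ofReal_im]
  -- the values at the two ends of the segment
  have hg0 : (w p).re = g μ := by rw [← hpμ, hwg μ ⟨le_rfl, by linarith⟩, Complex.ofReal_re]
  have hg1 : (w (p + (l : ℂ) * u)).re = g (μ + δ) := by
    rw [← he_eq (μ + δ) ⟨by linarith, le_rfl⟩, hwg (μ + δ) ⟨by linarith, le_rfl⟩,
      Complex.ofReal_re]
  have hμS : μ ∈ Icc S₀ S := htS μ ⟨le_rfl, by linarith⟩
  have hμδS : μ + δ ∈ Icc S₀ S := htS (μ + δ) ⟨by linarith, le_rfl⟩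
  -- points off the segment on the side `b` lie in the domain
  have hcarr : ∀ s ∈ Icc 0 l, ∀ y : ℝ, |y| < r / 2 → 0 < (if b then -y else y) →
      p + (s : ℂ) * u + (y : ℂ) * (Complex.I * u) ∈ R.carrier := by
    intro s hs y hy hpos
    refine (hside _ (ori_dist_frame_lt hu1 ?_)).2 ?_
    · rw [abs_of_nonneg hs.1]; linarith [hs.2]
    · rw [ori_frame_div hu0]
      simpa using hpos
  constructor
  · rintro rfl
    rcases hga with h | h
    · exact h
    exfalso
    have hle : (w p).re ≤ (w (p + (l : ℂ) * u)).re :=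
      ori_re_le_re_of_left hU hw hmaps hl0.le (half_pos hr) hsegU hreal fun s hs y hy =>
        hcarr s hs y (by rw [abs_of_pos hy.1]; exact hy.2) (by simpa using hy.1)
    have hlt := h hμS hμδS (by linarith)
    rw [hg0, hg1] at hle
    linarith
  · rintro rfl
    rcases hga with h | h
    swap
    · exact h
    exfalso
    -- walk the segment backwards: base `p + l u`, direction `-u`, domain again on the left
    have hls : ∀ s ∈ Icc 0 l, l - s ∈ Icc 0 l := fun s hs =>
      ⟨by linarith [hs.2], by linarith [hs.1]⟩
    have hpar : ∀ s : ℝ, p + (l : ℂ) * u + (s : ℂ) * (-u) = p + ((l - s : ℝ) : ℂ) * u := by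
      intro s; push_cast; ring
    have hle : (w (p + (l : ℂ) * u)).re ≤ (w (p + (l : ℂ) * u + (l : ℂ) * (-u))).re := by
      refine ori_re_le_re_of_left hU hw hmaps hl0.le (half_pos hr) (fun s hs => ?_)
        (fun s hs => ?_) fun s hs y hy => ?_
      · rw [hpar s]; exact hsegU (l - s) (hls s hs)
      · rw [hpar s]; exact hreal (l - s) (hls s hs)
      · have h1 : p + (l : ℂ) * u + (s : ℂ) * (-u) + (y : ℂ) * (Complex.I * (-u)) =
            p + ((l - s : ℝ) : ℂ) * u + ((-y : ℝ) : ℂ) * (Complex.I * u) := by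
          push_cast; ring
        rw [h1]
        exact hcarr (l - s) (hls s hs) (-y) (by rw [abs_neg, abs_of_pos hy.1]; exact hy.2)
          (by simpa using hy.1)
    have h2 : p + (l : ℂ) * u + (l : ℂ) * (-u) = p := by ring
    rw [h2, hg0, hg1] at hle
    have hlt := h hμS hμδS (by linarith)
    linarith

/-! ### The stub -/

/-- **Stub stub_orientation of line excursion-kernel-covariance** (registered signature, verbatim).
For a conformal rectangle with flat marks: (i) the orientation dichotomy at the flat mark
`a = pt 0` — an axis direction `u ∈ {1, i, -1, -i}` and `r > 0` with the loop moving strictly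
forward along `u` for parameters in `(mark 0 - r, mark 0 + r)` and the domain meeting `B(a, r)` in
exactly the left (`b = false`) or the right (`b = true`) open half-disc; (ii) matching — a chart
`w` holomorphic on an open `U ∋ a`, mapping the domain into the upper half-plane, with real
boundary values `g` near `mark 0` that are strictly monotone or antitone on `[S₀, S] ∋ mark 0`, has
`g` increasing if `b = false` and decreasing if `b = true`. [folklore] -/
theorem stub_orientation :
    ∀ R : ConformalRectangle, FlatMarks R →
      ∃ b : Bool,
        (∃ u : ℂ, (u = 1 ∨ u = Complex.I ∨ u = -1 ∨ u = -Complex.I) ∧ ∃ r : ℝ, 0 < r ∧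
          (∀ t t' : ℝ, R.mark 0 - r < t → t < t' → t' < R.mark 0 + r →
            0 < ((R.boundary t' - R.boundary t) / u).re ∧
              ((R.boundary t' - R.boundary t) / u).im = 0) ∧
          (∀ z : ℂ, dist z (R.pt 0) < r →
            (z ∈ R.carrier ↔ 0 < (if b then -((z - R.pt 0) / u).im else ((z - R.pt 0) / u).im)))) ∧
        ∀ (U : Set ℂ) (w : ℂ → ℂ) (g : ℝ → ℝ) (S₀ S : ℝ), IsOpen U → R.pt 0 ∈ U →
          DifferentiableOn ℂ w U → MapsTo w R.carrier {z : ℂ | 0 < z.im} →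
          S₀ < R.mark 0 → R.mark 0 < S →
          (∀ t ∈ Icc S₀ S, R.boundary t ∈ U → w (R.boundary t) = g t) →
          (StrictMonoOn g (Icc S₀ S) ∨ StrictAntiOn g (Icc S₀ S)) →
          (b = false → StrictMonoOn g (Icc S₀ S)) ∧ (b = true → StrictAntiOn g (Icc S₀ S)) := by
  intro R hR
  obtain ⟨b, u, hu, r, hr, hfwd, hside⟩ := orientation_dichotomy_at_pt_zero R hR
  exact ⟨b, ⟨u, hu, r, hr, hfwd, hside⟩, fun U w g S₀ S hU hpU hw hmaps hS₀ hS hg hga =>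
    ori_matching R hu hr hfwd hside U w g S₀ S hU hpU hw hmaps hS₀ hS hg hga⟩

end Summit.CriticalPhenomena.CardyFormulaZ2.Cruxes.RectilinearCardy.ExcursionKernelCovariance

end
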